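import Literature.MathematicalPhysics.QuantumFieldTheory.Balaban1983to89.B9Eq387CubeReductionClosed
import Literature.MathematicalPhysics.QuantumFieldTheory.Balaban1983to89.B9Eq387CubeReductionClosedWindows
import Literature.MathematicalPhysics.QuantumFieldTheory.Balaban1983to89.B9Eq387CubeReductionGeometry

/-!
# `Balaban1983to89.B9Eq387CubeReductionClosedAdmissible` — T. Bałaban, *Propagators for lattice gauge theories in a background field*, Commun. Math. Phys.
# **99** (1985) 389–434 [Balaban1985BackgroundPropagators] (3.35) p. 396 («where O(1)M is a size of □»), Cor. 3.6 p. 408, p. 408 («R, M are sufficiently large …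
# M = KR₀M₀»), p. 409 l. 2–3 («number O(1) in the condition (3.35) can be taken as equal to 12»), (3.87)–(3.89) p. 409, Thm 3.11 p. 416 («for M sufficiently
# large and α₀ sufficiently small»): **ROW L10's (loc) FOR THE (3.35) CLASS IN CLOSED FORM — `∃ γ > 0, ∃ r₀ R` (from the constants alone), `∀ Nc, ∃ δ₀ > 0` such that
# every unitary background with ALL plaquettes `δ`-close to `1`, `δ ≤ δ₀`, satisfies the per-cube estimate `(γ∕2)‖A‖² ≤ ‖curl_U A‖² + ‖R(U)(D*_U A)‖² +
# ‖√a·Q_U A‖²` for cube fields `A`** — the junction of this lineage's `B9Eq387CubeReductionClosed.cube_loc_closed` ((K10): the estimate with its four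
# scalar windows DISPLAYED) and `B9Eq387CubeReductionClosedWindows.windows_admissible` ((K10-c): the windows are admissible in the right quantifier
# order); route R2′ STEP B8′, instance-ledger row L10 of the pub-balaban NE9 chain (`t4/ROUTES-NE9.md` v13.46)

statement-level skeleton of published theorems with citation tags; proofs where landed; nothing here is a claim about the Yang–Mills mass gap

CITATION HEADER (lean-in-tree rule).  Audit cell `pub-balaban`, sub-cell `t4`, BINDER row NE9; filed by NE9 formalisation-swarm LEAF PROVER 05
(`b2b-balaban-t4-ne9-formalise-leaf-05`, gen 79).  [folklore] composition BY NAME of the three files imported ((K10), (K10-c), (K11) `B9Eq387CubeReductionGeometry`); nothing else.  Source READ: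
[Balaban1985BackgroundPropagators] p. 396 (3.35) l. 23 («where O(1)M is a size of □ in T_{L^{−j}}» — the class of backgrounds, cube by cube), p. 408
Cor. 3.6 and l. 29–33 («We need two different scales, given by two sizes of big blocks … R, M are sufficiently large … M = KR₀M₀»), p. 409 l. 2–3 («number
O(1) in the condition (3.35) can be taken as equal to 12, thus the cube □̃ is contained in one of the cubes for which this condition holds») and (3.87)–(3.89)
(localisation to cubes — the collar radii BEFORE the cube), p. 416 Thm 3.11 l. 14–16 («for M sufficiently large and α₀ sufficiently small … positive
definite» — the smallness AFTER the cube; p. 390 l. 17 «ηA … in a sufficiently small neighbourhood of 0»).  Print's own constants are NOT asserted;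
`γ, r₀, R, δ₀` are the suppliers' `∃`.

WHY.  (K10) proves the per-cube (loc) estimate under DISPLAYED windows (W1) `ε̃ ≤ ε₂`, (W1′) `ε̃ ≤ ε_reg`, (W2) `ε̃ ≤ ε₁`, (W3) `ε_E ≤ 1 ∧ 3ε_EM_D² ≤ γ∕2`
and `hδr` (`ε̃ = |L(Nc+3)|₁·δ`); (K10-c) proves `∃ r₀ R, ∀ N₁, ∃ δ₀ > 0, ∀ δ ≤ δ₀`: all of them.  This file states the consumer's form: the ONLY
data left are `γ` (before everything), the radii (before the cube), and `δ₀(Nc)` (after the cube, before the volume and the background) — the shape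
ne9-leaf-01's Tier-P assembly over a partition into equal cubes consumes (one `Nc` for all cubes ⇒ one `δ₀`).

WHAT IS PROVED (sorry-free; proof lane — no `def`; [folklore]).  §1 **`cube_loc_closed_admissible`** — see its docstring; §2 **`cube_loc_closed_at_ctr`** — the
same AT EVERY CENTRE `z` of the `M₀`-cover of the fine torus, for bond fields supported where `hS_z ≠ 0` (the Tier-P fields `χ_B(z)A = hS_z • A`), the box
datum supplied by `B9Eq387CubeReductionGeometry.exists_box_of_ctr` under `2ρ + 2(r₀+R) + 4 ≤ m_i`, `M₀ ≤ Lρ` (`δ₀` depends on `ρ, r₀, R` only).  The binder `hδr : δ ≤ 1∕(64(L·d(L−1)+1))`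
stays DISPLAYED although implied by `δ ≤ δ₀` (the statement exports `δ₀ ≤` that threshold): it TYPES the term `Q_U := QtorusW … (alpha_le_64_of_le … hδr) …`.
HONEST SCOPE.  A junction BY NAME; NOT Tier P, NOT NE9; the SIZES (`γ₀(κ₁, d, L)`, row L10's NEEDS-CONSTANT) untouched; one level, small field everywhere
(large fields are another chapter).  Cell pub-balaban: NE9 NOT PRINTED ∕ NOT PROVED; «NE9 ⇐ the named binders»; row WALLED ON A MODEL (O-NE9-1; #5 UNRULED);
spine PROVED 0∕9; rung (B)+1 on a finite T⁴ — NOT infinite volume, NOT mass gap, NOT BetaPertH, NOT Clay; HONEST DEPENDENCY: continuum YM on T⁴ ⇐ BetaPertH ∧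
nine spine estimates (0/9 proved); BetaPertH ⇐ (D1) ∧ (D4) ∧ CAP+tail; G-an2-4 gates asym, D1 and NE2/3/4.  NEW file; nothing modified.  Net new unproved facts: 0.
-/

noncomputable section

set_option autoImplicit false

open scoped InnerProductSpace

namespace Literature.MathematicalPhysics.QuantumFieldTheory.Balaban1983to89.B9Eq387CubeReductionClosedAdmissible

open B4Sect5Torus (TSite)
open B9SectCLatticeCarrier (Bond bpos)
open B7Prop1Explicit (l1 U1)
open B9Eq315QTorus (QtorusW)
open B9Eq315QTorusOnto (liftSite)
open B9Eq310DeltaPrime (plaqHolU)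
open B9Eq311L2Pairing (WL2)
open B11Eq103H1Complex (BondL2K covDivL2K)
open B9Eq310HessianOperator (adTransportW covCurlL2K)
open B9Eq326OperatorAssembly (RofU)
open B9Eq328GaugeAction (AdW)
open B9Eq319QprimeTorus (fineP blockCoord)
open B9Eq335SmallBondsData (perCfg_mem_U1)
open B9Eq335SmallPlaquettesLocalData (hreg_of_small_plaquettes_local' alpha_le_64_of_le)
open B9Eq387CubeReductionClosed (cube_loc_closed)
open B9Eq387CubeReductionClosedWindows (windows_admissible)
open B9Eq387CubeReductionGeometry (exists_box_of_ctr)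
open B5TorusCover (Ctr)
open B5SmoothPartition (hS)

variable {d : ℕ} (L : ℕ) [NeZero L] (hL : 3 ≤ L)
  {𝔸 : Type*} [NormedRing 𝔸] [NormedAlgebra ℂ 𝔸] [CompleteSpace 𝔸] [NormOneClass 𝔸] [StarMul 𝔸]
  {W : Type*} [NormedAddCommGroup W] [InnerProductSpace ℂ W] [FiniteDimensional ℂ W] (φ : W ≃ₗ[ℂ] 𝔸) {Mφ Mφ' : ℝ}
  (hφ : ∀ w, ‖φ w‖ ≤ Mφ * ‖w‖) (hφ' : ∀ X, ‖φ.symm X‖ ≤ Mφ' * ‖X‖) (hMφ : 0 ≤ Mφ) (hMφ' : 0 ≤ Mφ')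
  (c₀ : ℝ) [Fact (0 < c₀)] (η : ℝ) (hη : 0 < η) (c₁ : ℝ) [Fact (0 < c₁)] (hc : c₁ = (L : ℝ) ^ (d + 1) * c₀) (hηL : η * L = 1)
  {a : ℝ} (ha : 0 < a)
  (hAdU : ∀ u : 𝔸ˣ, star ((u : 𝔸ˣ) : 𝔸) = ((u⁻¹ : 𝔸ˣ) : 𝔸) → ∀ v v' : W, ⟪AdW φ u v, AdW φ u v'⟫_ℂ = ⟪v, v'⟫_ℂ)

/-! ## §1 The window-free per-cube (loc) -/

include hL hφ hφ' hMφ hMφ' hη hc hηL ha hAdU in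
/-- **ROW L10's (loc) FOR THE (3.35) CLASS — CLOSED FORM.**  `∃ γ > 0` and collar radii `r₀, R ∈ ℕ_{>0}` (depending on the constants
`d, L, a, c₀, c₁, η, M_φ, M_φ′` only) such that for EVERY cube extent `Nc` there is a plaquette threshold `δ₀ > 0` (`δ₀ ≤` the `hδr`
threshold) with: for EVERY volume `m` (`Nc_i + 4 ≤ m_i`), EVERY unit-bounded UNITARY background `U` whose plaquette variables are ALL
`δ`-close to `1` with `0 ≤ δ ≤ δ₀` (and the displayed `hδr`, implied by `δ ≤ δ₀`, which TYPES the `Q_U` term), EVERY corner `y₁`, support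
blocks `Z₀ ⊆ y₁ + [r₀+R+1, Nc+1−(r₀+R)]` and EVERY bond field `A` supported over `Z₀`'s blocks:
`(γ∕2)‖A‖² ≤ ‖curl_U A‖² + ‖R(U)(D*_U A)‖² + ‖√a·Q_U A‖²`.  PROOF: `B9Eq387CubeReductionClosed.cube_loc_closed` (windows displayed) and the Mathlib-only
`B9Eq387CubeReductionClosedWindows.windows_admissible` at `θ₀ :=` the `hδr` threshold, `θ₁ := ε_reg(d+1, L)`, `M_D := 2√(d+1)(‖η⁻¹‖(1+1))`,
`N₁ := |L(Nc+3)|₁`. [folklore] (composition BY NAME)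
[cite: Balaban1985BackgroundPropagators, (3.35) p.396 «where O(1)M is a size of □», Cor 3.6 p.408, (3.87)–(3.89) p.409, Thm 3.11 p.416 «for M sufficiently large and α₀ sufficiently small»] -/
theorem cube_loc_closed_admissible (hL1 : 1 ≤ L) :
    ∃ γ : ℝ, ∃ r₀ R : ℕ, 0 < γ ∧ 0 < r₀ ∧ 0 < R ∧
      ∀ Nc : B7Prop1Explicit.Site (d + 1), ∃ δ₀ : ℝ, 0 < δ₀ ∧
        δ₀ ≤ 1 / (64 * ((L : ℝ) * ((((d + 1 : ℕ) : ℝ) - 1) * ((L : ℝ) - 1)) + 1)) ∧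
        ∀ (m : Fin (d + 1) → ℕ) [∀ i, NeZero (m i)] [∀ i, NeZero (fineP L m i)]
          (U : Bond (d + 1) (fineP L m) → 𝔸ˣ) (hU : ∀ b, U b ∈ U1 𝔸) (hUstar : ∀ b, star ((U b : 𝔸ˣ) : 𝔸) = (((U b)⁻¹ : 𝔸ˣ) : 𝔸))
          {δ : ℝ} (hδ0 : 0 ≤ δ)
          (hδr : δ ≤ 1 / (64 * ((L : ℝ) * ((((d + 1 : ℕ) : ℝ) - 1) * ((L : ℝ) - 1)) + 1))) (hδ1 : δ ≤ δ₀)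
          (hδ : ∀ p : B9SectCLatticeCarrier.Plaq (d + 1) (fineP L m), ‖(plaqHolU U p : 𝔸) - 1‖ ≤ δ)
          (hNm : ∀ i, Nc i + 4 ≤ (m i : ℤ)) (y₁ : TSite (d + 1) m) (Z₀ : Finset (TSite (d + 1) m))
          (hZ₀ : ∀ z ∈ Z₀, ∀ i, ((r₀ + R : ℕ) : ℤ) + 1 ≤ liftSite (z - y₁) i ∧ liftSite (z - y₁) i + (r₀ + R : ℕ) ≤ Nc i + 1)
          (A : BondL2K ℂ (d + 1) (fineP L m) c₀ W)
          (hA : ∀ b : Bond (d + 1) (fineP L m), blockCoord L m (bpos b) ∉ Z₀ → WL2.equiv ℂ _ W A b = 0),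
          (γ / 2) * ‖A‖ ^ 2 ≤
            ‖covCurlL2K ℂ c₀ ((η : ℂ))⁻¹ (adTransportW φ U) A‖ ^ 2 +
              ‖RofU L m φ η U (c₀ := c₀) (covDivL2K ℂ c₀ ((η : ℂ))⁻¹ (adTransportW φ fun b => (U b)⁻¹) A)‖ ^ 2 +
              ‖((Real.sqrt a : ℝ) : ℂ) • QtorusW L m hL1 φ U (alpha_le_64_of_le L (d := d + 1) hL1 (Nat.succ_pos d) hδr)
                  (perCfg_mem_U1 L m hU) (hreg_of_small_plaquettes_local' L m hU hδ hδ0) (c₁ := c₁) A‖ ^ 2 := by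
  obtain ⟨γ, ε₂, ε₁, κ, C, hγ, hε₂, hε₁, hε₁1, hκ, hC, hq, H⟩ :=
    cube_loc_closed (d := d) L hL φ hφ hφ' hMφ hMφ' c₀ η hη c₁ hc hηL ha hAdU hL1
  -- the two fixed thresholds are positive
  have hL1' : (1 : ℝ) ≤ (L : ℝ) := by exact_mod_cast hL1
  have hd1 : (1 : ℝ) ≤ ((d + 1 : ℕ) : ℝ) := by exact_mod_cast Nat.succ_le_succ (Nat.zero_le d)
  have hθ₀ : (0 : ℝ) < 1 / (64 * ((L : ℝ) * ((((d + 1 : ℕ) : ℝ) - 1) * ((L : ℝ) - 1)) + 1)) := by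
    have h0 : (0 : ℝ) ≤ (L : ℝ) * ((((d + 1 : ℕ) : ℝ) - 1) * ((L : ℝ) - 1)) :=
      mul_nonneg (by linarith) (mul_nonneg (by linarith) (by linarith))
    exact div_pos one_pos (by linarith)
  have hθ₁ : (0 : ℝ) < 1 / (256 * (((d + 1 : ℕ) : ℝ) + 1) ^ 2 * (L : ℝ) ^ ((d + 1) + 1)) := by
    have hL0 : (0 : ℝ) < (L : ℝ) := by linarith
    positivity
  obtain ⟨r₀, R, hr₀, hR, HW⟩ := windows_admissible (d := d) (L := L) hC hκ hMφ hMφ' hε₁.le hq hε₁1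
    (MD := 2 * Real.sqrt ((d + 1 : ℕ) : ℝ) * (‖((η : ℂ))⁻¹‖ * (1 + 1))) hγ hε₂ hθ₀ hθ₁ hε₁
  refine ⟨γ, r₀, R, hγ, hr₀, hR, fun Nc => ?_⟩
  obtain ⟨δ₀, hδ₀, Hδ⟩ := HW (l1 (fun i => (L : ℤ) * (Nc i + 3)))
  refine ⟨δ₀, hδ₀, (Hδ δ₀ hδ₀.le le_rfl).1, ?_⟩
  intro m _ _ U hU hUstar δ hδ0 hδr hδ1 hδ hNm y₁ Z₀ hZ₀ A hA
  obtain ⟨-, hw1, hw1', hw2, hE1, hEγ⟩ := Hδ δ hδ0 hδ1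
  exact H m U hU hUstar hδ0 hδr hδ r₀ R hr₀ hR Nc hNm y₁ Z₀ hZ₀ hw1 hw1' hw2 hEγ hE1 A hA

/-! ## §2 The same at every centre of the `M₀`-cover (the Tier-P socket) -/

include hL hφ hφ' hMφ hMφ' hη hc hηL ha hAdU in
/-- **ROW L10's (loc) AT EVERY TIER-P CUBE.**  `∃ γ > 0, ∃ r₀ R ∈ ℕ_{>0}` such that for every cover scale `M₀ ≥ 1` and coarse radius `ρ` with
`M₀ ≤ Lρ` there is `δ₀ > 0` (depending on `ρ, r₀, R` and the constants only; `δ₀ ≤` the `hδr` threshold) with: for EVERY volume `m` with room for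
support plus collars (`2ρ + 2(r₀+R) + 4 ≤ m_i`), EVERY unit-bounded UNITARY background `U` with ALL plaquettes `δ`-close, `0 ≤ δ ≤ δ₀` (and the
displayed `hδr`), EVERY centre `z : Ctr (fineP L m) M₀` and EVERY bond field `A` vanishing wherever `hS_z` vanishes (e.g. `hS_z • A`):
`(γ∕2)‖A‖² ≤ ‖curl_U A‖² + ‖R(U)(D*_U A)‖² + ‖√a·Q_U A‖²`.  PROOF: §1 at the constant extent `Nc := 2ρ + 2(r₀+R)` and
`B9Eq387CubeReductionGeometry.exists_box_of_ctr`. [folklore] (composition BY NAME)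
[cite: Balaban1985BackgroundPropagators, (3.35) p.396 «where O(1)M is a size of □», p.408 «a family of cubes □, with centers at points of this lattice», Cor 3.6 p.408, (3.87)–(3.89) p.409, Thm 3.11 p.416] -/
theorem cube_loc_closed_at_ctr (hL1 : 1 ≤ L) :
    ∃ γ : ℝ, ∃ r₀ R : ℕ, 0 < γ ∧ 0 < r₀ ∧ 0 < R ∧
      ∀ (M₀ ρ : ℕ), 1 ≤ M₀ → M₀ ≤ L * ρ → ∃ δ₀ : ℝ, 0 < δ₀ ∧
        δ₀ ≤ 1 / (64 * ((L : ℝ) * ((((d + 1 : ℕ) : ℝ) - 1) * ((L : ℝ) - 1)) + 1)) ∧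
        ∀ (m : Fin (d + 1) → ℕ) [∀ i, NeZero (m i)] [∀ i, NeZero (fineP L m i)]
          (hfit : ∀ i, 2 * ρ + 2 * (r₀ + R) + 4 ≤ m i)
          (U : Bond (d + 1) (fineP L m) → 𝔸ˣ) (hU : ∀ b, U b ∈ U1 𝔸) (hUstar : ∀ b, star ((U b : 𝔸ˣ) : 𝔸) = (((U b)⁻¹ : 𝔸ˣ) : 𝔸))
          {δ : ℝ} (hδ0 : 0 ≤ δ)
          (hδr : δ ≤ 1 / (64 * ((L : ℝ) * ((((d + 1 : ℕ) : ℝ) - 1) * ((L : ℝ) - 1)) + 1))) (hδ1 : δ ≤ δ₀)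
          (hδ : ∀ p : B9SectCLatticeCarrier.Plaq (d + 1) (fineP L m), ‖(plaqHolU U p : 𝔸) - 1‖ ≤ δ)
          (z : Ctr (fineP L m) M₀) (A : BondL2K ℂ (d + 1) (fineP L m) c₀ W)
          (hA : ∀ b : Bond (d + 1) (fineP L m), hS (fineP L m) M₀ z (bpos b) = 0 → WL2.equiv ℂ _ W A b = 0),
          (γ / 2) * ‖A‖ ^ 2 ≤
            ‖covCurlL2K ℂ c₀ ((η : ℂ))⁻¹ (adTransportW φ U) A‖ ^ 2 +
              ‖RofU L m φ η U (c₀ := c₀) (covDivL2K ℂ c₀ ((η : ℂ))⁻¹ (adTransportW φ fun b => (U b)⁻¹) A)‖ ^ 2 +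
              ‖((Real.sqrt a : ℝ) : ℂ) • QtorusW L m hL1 φ U (alpha_le_64_of_le L (d := d + 1) hL1 (Nat.succ_pos d) hδr)
                  (perCfg_mem_U1 L m hU) (hreg_of_small_plaquettes_local' L m hU hδ hδ0) (c₁ := c₁) A‖ ^ 2 := by
  obtain ⟨γ, r₀, R, hγ, hr₀, hR, H⟩ :=
    cube_loc_closed_admissible (d := d) L hL φ hφ hφ' hMφ hMφ' c₀ η hη c₁ hc hηL ha hAdU hL1
  refine ⟨γ, r₀, R, hγ, hr₀, hR, fun M₀ ρ hM hρ => ?_⟩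
  obtain ⟨δ₀, hδ₀, hδ₀r, Hδ⟩ := H (fun _ => ((2 * ρ + 2 * (r₀ + R) : ℕ) : ℤ))
  refine ⟨δ₀, hδ₀, hδ₀r, ?_⟩
  intro m _ _ hfit U hU hUstar δ hδ0 hδr hδ1 hδ z A hA
  have hP : ∀ i, 1 ≤ fineP L m i := fun i => Nat.one_le_iff_ne_zero.mpr (NeZero.ne (fineP L m i))
  obtain ⟨y₁, Z₀, hNm, hZ₀, hsupp⟩ := exists_box_of_ctr L hP hM hρ r₀ R hfit z
  exact Hδ m U hU hUstar hδ0 hδr hδ1 hδ hNm y₁ Z₀ hZ₀ A (fun b hb => hA b (hsupp (bpos b) hb))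

end Literature.MathematicalPhysics.QuantumFieldTheory.Balaban1983to89.B9Eq387CubeReductionClosedAdmissible

end
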